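import Literature.Topology.FourManifolds.NonSeparatingSpheresDegree
import Literature.Topology.FourManifolds.NonSeparatingSpheresLoopHomotopy
import Literature.Topology.FourManifolds.NonSeparatingSpheresStandardLoop
import Literature.Topology.FourManifolds.HomotopicCirclesIsotopic
import HarnessLib

/-!
# Budney–Gabai Thm. 3.13: the dual circle of a non-separating sphere is carried onto `S¹ × {p₀}`
# by a diffeomorphism of `S¹ × Sⁿ`, `n ≥ 3`

Fact seat of `Literature.Topology.FourManifolds.BudneyGabai2019_thm_3_13` (R. Budney, D. Gabai,
*Knotted 3-balls in `S⁴`*, arXiv:1912.09029, Thm. 3.13).  The second sentence of the printed proof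
(p. 22): *"Since `dim(S¹ × Sⁿ) ≥ 4`, we can isotope our embedding to be equal to `S¹ × {*}` and
similarly isotope our non-separating sphere."*  This file proves it
(`BudneyGabai2019_thm_3_13.exists_diffeomorph_dualCircle_standard`): for a smoothly embedded
`n`-sphere `e : Sⁿ → S¹ × Sⁿ`, `n ≥ 3`, with connected complement, `x₀ ∈ Sⁿ` and `p₀ ∈ Sⁿ`, there
are a dual circle `c` (a smoothly embedded circle meeting `e(Sⁿ)` exactly in `c s₀ = e x₀`,
transversally) and a diffeomorphism `Ψ` of `S¹ × Sⁿ` with `Ψ ∘ c` a standard parametrisation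
`s ↦ (e^{ia} ι(s)^{±1}, p₀)` of the fibre circle `S¹ × {p₀}`.  Hence, after the ambient
diffeomorphism `Ψ` (which does not change the problem, `NonSeparatingSpheresReduction.lean`),
the non-separating sphere `Ψ(e(Sⁿ))` meets `S¹ × {p₀}` in exactly one point
(`BudneyGabai2019_thm_3_13.exists_sphere_meeting_standardCircle_once`).

## Proof

The dual circle has degree `d = ±1` over `S¹` (`NonSeparatingSpheresDegree.lean`), hence is
homotopic to the standard loop of degree `d` (`NonSeparatingSpheresLoopHomotopy.lean`), a
smoothly embedded circle with image `S¹ × {p₀}` (`NonSeparatingSpheresStandardLoop.lean`).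
Re-chart `S¹ × Sⁿ` on `ℝⁿ⁺¹` (`Literature.Geometry.Manifold.Rechart`); there, homotopic embedded
circles are smoothly isotopic since `n + 1 ≥ 4` (Whitney 1936; Milnor 1965, Thm. 8.4 and Remark —
the tree's `isSmoothlyIsotopic_circle_of_homotopic`), a smooth isotopy of a compact submanifold
of a closed manifold is ambient (isotopy extension, Milnor Thm. 5.8 — the tree's
`isAmbientIsotopic_of_isSmoothlyIsotopic_euclidean`), and the end diffeomorphism is conjugated
back to `S¹ × Sⁿ`.

Everything here is proved; no definition and no named fact is introduced.

## References

* R. Budney, D. Gabai, *Knotted 3-balls in `S⁴`*, arXiv:1912.09029 (v2), §3, proof of Thm. 3.13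
  (p. 22). [BudneyGabai2019]
* H. Whitney, *Differentiable manifolds*, Ann. of Math. 37 (1936), §II Thm. 6. [Whitney1936]
* J. Milnor, *Lectures on the h-cobordism theorem* (1965), Thm. 5.8, Thm. 8.4 and Remark.
  [MilnorHCobordism1965]
-/

noncomputable section

open scoped Manifold ContDiff Topology Real
open Set Function Metric Module Filter
open Literature.Geometry.Manifold

namespace Literature.Topology.FourManifolds

namespace BudneyGabai2019_thm_3_13

variable {n : ℕ}

/-- **The dual circle of a non-separating sphere is standard up to a diffeomorphism of
`S¹ × Sⁿ`, `n ≥ 3`** (Budney–Gabai 2019, proof of Thm. 3.13, second sentence).  For a smoothly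
embedded `n`-sphere `e : Sⁿ → S¹ × Sⁿ`, `n ≥ 3`, whose image has connected complement, and points
`x₀, p₀ ∈ Sⁿ`, there are: a smoothly embedded circle `c` meeting `e(Sⁿ)` exactly in `c s₀ = e x₀`
and equal near that point to a normal arc `γ` of `e(Sⁿ)` (`γ 0 = e x₀`, `γ'(0) ∉ de_{x₀}(T Sⁿ)`);
a phase `a`, a sign `d = ±1`; and a diffeomorphism `Ψ` of `S¹ × Sⁿ` with
`Ψ (c s) = (e^{ia} ι(s)^d, p₀)` for all `s` (`ι = toCircle : 𝕊¹ ≅ Circle`).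
[cite: BudneyGabai2019, proof of Thm. 3.13 (arXiv:1912.09029 v2, p. 22)]
[cite: MilnorHCobordism1965, Thm. 8.4 with Remark, Thm. 5.8] -/
theorem exists_diffeomorph_dualCircle_standard (hn : 3 ≤ n)
    {e : Metric.sphere (0 : EuclideanSpace ℝ (Fin (n + 1))) 1 →
      Circle × Metric.sphere (0 : EuclideanSpace ℝ (Fin (n + 1))) 1}
    (he : Manifold.IsSmoothEmbedding (𝓡 n) ((𝓡 1).prod (𝓡 n)) ∞ e)
    (hconn : IsConnected (range e)ᶜ)
    (x₀ p₀ : Metric.sphere (0 : EuclideanSpace ℝ (Fin (n + 1))) 1) :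
    ∃ (c : Metric.sphere (0 : EuclideanSpace ℝ (Fin 2)) 1 →
        Circle × Metric.sphere (0 : EuclideanSpace ℝ (Fin (n + 1))) 1)
      (s₀ : Metric.sphere (0 : EuclideanSpace ℝ (Fin 2)) 1) (a : ℝ) (d : ℤ)
      (Ψ : (Circle × Metric.sphere (0 : EuclideanSpace ℝ (Fin (n + 1))) 1) ≃ₘ⟮(𝓡 1).prod (𝓡 n),
        (𝓡 1).prod (𝓡 n)⟯ (Circle × Metric.sphere (0 : EuclideanSpace ℝ (Fin (n + 1))) 1)),
      Manifold.IsSmoothEmbedding (𝓡 1) ((𝓡 1).prod (𝓡 n)) ∞ c ∧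
      c s₀ = e x₀ ∧ (∀ s, s ≠ s₀ → c s ∉ range e) ∧
      (∃ γ : ℝ → Circle × Metric.sphere (0 : EuclideanSpace ℝ (Fin (n + 1))) 1,
        ContMDiff 𝓘(ℝ, ℝ) ((𝓡 1).prod (𝓡 n)) ∞ γ ∧ Injective γ ∧
        (∀ s, Injective (mfderiv 𝓘(ℝ, ℝ) ((𝓡 1).prod (𝓡 n)) γ s)) ∧ γ 0 = e x₀ ∧
        (mfderiv 𝓘(ℝ, ℝ) ((𝓡 1).prod (𝓡 n)) γ 0 (1 : ℝ) :
            EuclideanSpace ℝ (Fin 1) × EuclideanSpace ℝ (Fin n)) ∉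
          (mfderiv (𝓡 n) ((𝓡 1).prod (𝓡 n)) e x₀).range ∧
        ∃ U ∈ 𝓝 (e x₀), range c ∩ U = γ '' Icc (-1) 1 ∩ U) ∧
      (d = 1 ∨ d = -1) ∧
      ∀ s, Ψ (c s) = (Circle.exp a * toCircle s ^ d, p₀) := by
  set P := Circle × Metric.sphere (0 : EuclideanSpace ℝ (Fin (n + 1))) 1 with hP
  -- ### the dual circle and its degree
  obtain ⟨c, hc, ⟨s₀, hcs₀, hcoff⟩, hγdata, ct, d, hctc, hct, hdeck, hd⟩ :=
    exists_dualCircle_degree (n := n) (by omega) he hconn x₀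
  have hcc : Continuous c := hc.contMDiff.continuous
  set a : ℝ := (ct 0).1 with ha
  -- ### the standard loop of the same degree and the homotopy
  set u : Metric.sphere (0 : EuclideanSpace ℝ (Fin 2)) 1 →
      Circle × Metric.sphere (0 : EuclideanSpace ℝ (Fin (n + 1))) 1 :=
    fun s ↦ ((Circle.exp a * toCircle s ^ d, p₀) : Circle × Metric.sphere (0 : EuclideanSpace ℝ (Fin (n + 1))) 1)
    with hu
  have hue : Manifold.IsSmoothEmbedding (𝓡 1) ((𝓡 1).prod (𝓡 n)) ∞ u :=
    isSmoothEmbedding_standardLoop a hd p₀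
  have huc : Continuous u := hue.contMDiff.continuous
  set cC : C(Metric.sphere (0 : EuclideanSpace ℝ (Fin 2)) 1,
      Circle × Metric.sphere (0 : EuclideanSpace ℝ (Fin (n + 1))) 1) := ⟨c, hcc⟩ with hcC
  have hhom : cC.Homotopic ⟨u, huc⟩ :=
    homotopic_standardLoop_of_loopLift (n := n) (by omega) cC hctc hct hdeck p₀ ⟨u, huc⟩
      (fun s ↦ rfl)
  -- ### re-charting `S¹ × Sⁿ` on `ℝⁿ⁺¹`
  have hE' : finrank ℝ (EuclideanSpace ℝ (Fin 1) × EuclideanSpace ℝ (Fin n)) = n + 1 := by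
    rw [finrank_prod, finrank_euclideanSpace_fin, finrank_euclideanSpace_fin]
    omega
  set Λ : (EuclideanSpace ℝ (Fin 1) × EuclideanSpace ℝ (Fin n)) ≃L[ℝ] EuclideanSpace ℝ (Fin (n + 1)) :=
    ContinuousLinearEquiv.ofFinrankEq (by rw [hE', finrank_euclideanSpace_fin]) with hΛ
  set φ : ModelProd (EuclideanSpace ℝ (Fin 1)) (EuclideanSpace ℝ (Fin n)) ≃ₜ EuclideanSpace ℝ (Fin (n + 1)) :=
    ((𝓡 1).prod (𝓡 n)).toHomeomorph.trans Λ.toHomeomorph with hφ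
  have hφJ : ∀ x, φ x = Λ (((𝓡 1).prod (𝓡 n)) x) := fun x ↦ rfl
  have hφs : ContMDiff ((𝓡 1).prod (𝓡 n)) (𝓡 (n + 1)) ∞ φ := Rechart.contMDiff_of_apply_eq_linear φ Λ hφJ
  have hφs' : ContMDiff (𝓡 (n + 1)) ((𝓡 1).prod (𝓡 n)) ∞ φ.symm := Rechart.contMDiff_symm_of_apply_eq_linear φ Λ hφJ
  haveI : IsManifold (𝓡 (n + 1)) ∞ (Rechart φ P) := Rechart.isManifold φ P hφs hφs'
  haveI : SecondCountableTopology (Rechart φ P) := inferInstanceAs (SecondCountableTopology P)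
  set ι : P → Rechart φ P := Rechart.into φ P with hι
  set ρ : Rechart φ P → P := Rechart.out φ P with hρ
  have hιs : ContMDiff ((𝓡 1).prod (𝓡 n)) (𝓡 (n + 1)) ∞ ι := Rechart.contMDiff_into φ P hφs hφs'
  have hρs : ContMDiff (𝓡 (n + 1)) ((𝓡 1).prod (𝓡 n)) ∞ ρ := Rechart.contMDiff_out φ P hφs hφs'
  have hρι : ∀ x, ρ (ι x) = x := fun x ↦ rfl
  have hιρ : ∀ y, ι (ρ y) = y := fun y ↦ rfl
  -- the identity as a diffeomorphism between the two structures
  let D : P ≃ₘ⟮((𝓡 1).prod (𝓡 n)), 𝓡 (n + 1)⟯ Rechart φ P :=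
    { toEquiv := ⟨ι, ρ, hρι, hιρ⟩
      contMDiff_toFun := hιs
      contMDiff_invFun := hρs }
  have hdι : ∀ x, Injective (mfderiv ((𝓡 1).prod (𝓡 n)) (𝓡 (n + 1)) ι x) := fun x ↦ by
    have h1 : mfderiv ((𝓡 1).prod (𝓡 n)) ((𝓡 1).prod (𝓡 n)) (ρ ∘ ι) x = (mfderiv (𝓡 (n + 1)) ((𝓡 1).prod (𝓡 n)) ρ (ι x)).comp (mfderiv ((𝓡 1).prod (𝓡 n)) (𝓡 (n + 1)) ι x) :=
      mfderiv_comp x (hρs.mdifferentiableAt (by simp)) (hιs.mdifferentiableAt (by simp))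
    have h2 : mfderiv ((𝓡 1).prod (𝓡 n)) ((𝓡 1).prod (𝓡 n)) (ρ ∘ ι) x = ContinuousLinearMap.id ℝ (TangentSpace ((𝓡 1).prod (𝓡 n)) x) := by
      have : ρ ∘ ι = id := funext hρι
      rw [this, mfderiv_id]
    have h3 : Injective (mfderiv ((𝓡 1).prod (𝓡 n)) ((𝓡 1).prod (𝓡 n)) (ρ ∘ ι) x) := by
      rw [h2]; exact injective_id
    rw [h1] at h3
    have key : Injective (⇑(mfderiv (𝓡 (n + 1)) ((𝓡 1).prod (𝓡 n)) ρ (ι x)) ∘ ⇑(mfderiv ((𝓡 1).prod (𝓡 n)) (𝓡 (n + 1)) ι x)) := h3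
    exact key.of_comp
  -- pushing embedded circles forward
  have hpush : ∀ {f : Metric.sphere (0 : EuclideanSpace ℝ (Fin 2)) 1 → P},
      Manifold.IsSmoothEmbedding (𝓡 1) ((𝓡 1).prod (𝓡 n)) ∞ f →
        Manifold.IsSmoothEmbedding (𝓡 1) (𝓡 (n + 1)) ∞ (ι ∘ f) := by
    intro f hf
    refine isSmoothEmbedding_of_injective_of_injective_mfderiv (hιs.comp hf.contMDiff) (by simp)
      (fun s t h ↦ hf.isEmbedding.injective h) fun s ↦ ?_
    rw [mfderiv_comp s (hιs.mdifferentiableAt (by simp)) (hf.contMDiff.mdifferentiableAt (by simp))]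
    have key : Injective (⇑(mfderiv ((𝓡 1).prod (𝓡 n)) (𝓡 (n + 1)) ι (f s)) ∘ ⇑(mfderiv (𝓡 1) ((𝓡 1).prod (𝓡 n)) f s)) :=
      (hdι _).comp (mfderiv_injective_of_isImmersion hf.isImmersion (by simp) s)
    exact key
  set ιC : C(P, Rechart φ P) := ⟨ι, hιs.continuous⟩ with hιC
  set cV : C(Metric.sphere (0 : EuclideanSpace ℝ (Fin 2)) 1, Rechart φ P) := ιC.comp cC with hcVdef
  set uV : C(Metric.sphere (0 : EuclideanSpace ℝ (Fin 2)) 1, Rechart φ P) := ιC.comp ⟨u, huc⟩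
    with huVdef
  have hcV : Manifold.IsSmoothEmbedding (𝓡 1) (𝓡 (n + 1)) ∞ (⇑cV) := hpush hc
  have huV : Manifold.IsSmoothEmbedding (𝓡 1) (𝓡 (n + 1)) ∞ (⇑uV) := hpush hue
  have hhomV : cV.Homotopic uV :=
    ContinuousMap.Homotopic.comp (ContinuousMap.Homotopic.refl ιC) hhom
  -- ### Whitney and isotopy extension in the re-charted manifold
  have hiso : IsSmoothlyIsotopic (𝓡 1) (𝓡 (n + 1)) cV uV :=
    isSmoothlyIsotopic_circle_of_homotopic (by omega) cV uV hcV huV hhomV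
  have hamb : IsAmbientIsotopic (𝓡 1) (𝓡 (n + 1)) (⇑cV) (⇑uV) :=
    isAmbientIsotopic_of_isSmoothlyIsotopic_euclidean (⇑cV) (⇑uV) hiso
  obtain ⟨F, hF⟩ := hamb
  set ΨV := F.toDiffeomorph 1 with hΨV
  have hΨV : ∀ y, ΨV y = F.toFun 1 y := fun y ↦ rfl
  -- ### conjugating back
  refine ⟨c, s₀, a, d, D.trans (ΨV.trans D.symm), hc, hcs₀, hcoff, hγdata, hd, fun s ↦ ?_⟩
  have hD : ∀ x, D x = ι x := fun x ↦ rfl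
  have hDs : ∀ y, D.symm y = ρ y := fun y ↦ rfl
  rw [Diffeomorph.coe_trans, Diffeomorph.coe_trans, comp_apply, comp_apply, hD, hDs, hΨV]
  have h1 : F.toFun 1 (ι (c s)) = ι (u s) := by
    have := congr_fun hF s
    exact this
  rw [h1, hρι]

/-- **After a diffeomorphism, a non-separating sphere meets the standard circle `S¹ × {p₀}`
exactly once** (Budney–Gabai 2019, proof of Thm. 3.13, after the second sentence).  For a
smoothly embedded `n`-sphere `e : Sⁿ → S¹ × Sⁿ`, `n ≥ 3`, with connected complement and
`x₀, p₀ ∈ Sⁿ`, there is a diffeomorphism `Ψ` of `S¹ × Sⁿ` such that the (again smoothly embedded,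
non-separating) sphere `Ψ ∘ e` meets `S¹ × {p₀}` exactly in the point `Ψ (e x₀)`.
[cite: BudneyGabai2019, proof of Thm. 3.13 (arXiv:1912.09029 v2, p. 22)] -/
theorem exists_sphere_meeting_standardCircle_once (hn : 3 ≤ n)
    {e : Metric.sphere (0 : EuclideanSpace ℝ (Fin (n + 1))) 1 →
      Circle × Metric.sphere (0 : EuclideanSpace ℝ (Fin (n + 1))) 1}
    (he : Manifold.IsSmoothEmbedding (𝓡 n) ((𝓡 1).prod (𝓡 n)) ∞ e)
    (hconn : IsConnected (range e)ᶜ)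
    (x₀ p₀ : Metric.sphere (0 : EuclideanSpace ℝ (Fin (n + 1))) 1) :
    ∃ Ψ : (Circle × Metric.sphere (0 : EuclideanSpace ℝ (Fin (n + 1))) 1) ≃ₘ⟮(𝓡 1).prod (𝓡 n),
        (𝓡 1).prod (𝓡 n)⟯ (Circle × Metric.sphere (0 : EuclideanSpace ℝ (Fin (n + 1))) 1),
      Manifold.IsSmoothEmbedding (𝓡 n) ((𝓡 1).prod (𝓡 n)) ∞ (Ψ ∘ e) ∧
      IsConnected (range (Ψ ∘ e))ᶜ ∧
      range (Ψ ∘ e) ∩ (univ : Set Circle) ×ˢ ({p₀} : Set (Metric.sphere (0 : EuclideanSpace ℝ (Fin (n + 1))) 1)) =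
        {Ψ (e x₀)} := by
  obtain ⟨c, s₀, a, d, Ψ, hc, hcs₀, hcoff, -, hd, hΨc⟩ :=
    exists_diffeomorph_dualCircle_standard hn he hconn x₀ p₀
  refine ⟨Ψ, he.diffeomorph_comp Ψ,
    (isConnected_compl_range_diffeomorph_comp_iff Ψ e).2 hconn, ?_⟩
  -- the standard circle is `Ψ ∘ c`
  have hstd : (univ : Set Circle) ×ˢ ({p₀} : Set (Metric.sphere (0 : EuclideanSpace ℝ (Fin (n + 1))) 1)) =
      range (Ψ ∘ c) := by
    rw [← range_standardLoop a hd p₀]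
    congr 1
    funext s
    exact (hΨc s).symm
  rw [hstd, range_comp, range_comp, ← image_inter (EquivLike.injective Ψ)]
  have hint : range e ∩ range c = {e x₀} := by
    ext y
    simp only [mem_inter_iff, mem_range, mem_singleton_iff]
    constructor
    · rintro ⟨⟨x, rfl⟩, s, hs⟩
      have hs₀' : s = s₀ := by
        by_contra h
        exact hcoff s h ⟨x, hs.symm⟩
      rw [← hs, hs₀', hcs₀]
    · rintro rfl
      exact ⟨⟨x₀, rfl⟩, s₀, hcs₀⟩
  rw [hint, image_singleton]

end BudneyGabai2019_thm_3_13

end Literature.Topology.FourManifolds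

end
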